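import Literature.Probability.LatticeModels.FKObservableL2Bound
import HarnessLib

/-!
# From a bulk `L²` bound to a sup bound, for bond functions s-holomorphic in the bulk

Topic `Literature/Probability/LatticeModels`; the generic form of the second half of
`FKObservableL2Bound.lean` (Smirnov 2010, end of §5: precompactness of `F_δ/√δ` from Lemma 5.3 and
the regularity of discrete harmonic functions), separated from the FK-Ising observable so that it
serves the spin fermion of Chelkak–Hongler–Izyurov 2015 (Thm 3.12, after Chelkak–Smirnov 2012) as
well (`KCObservableL2Bound.lean` supplies its `L²` bound):

* `isLatticeHarmonicOn_edgeFun_of_isSHolAt`: if a bond function `G` is s-holomorphic at the four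
  corners of every site of the ball of radius `R + 2`, the real and imaginary parts of its
  horizontal and vertical edge functions are lattice-harmonic on the ball of radius `R`
  (`DiscreteCauchyRiemann.lean`: Cauchy–Riemann at vertices and faces, five-point identity);
* **`norm_le_of_harmonic_of_sum_sq_le`**: if `Re g`, `Im g` are lattice-harmonic on the ball of
  radius `4m` about the centre of a box of side `4m`, `m = 4p`, `p ≥ 8`, and
  `∑_{ball m} ‖g‖² ≤ K m`, then `‖g x‖ ≤ 96 C_geom √(4K) / √p` on the ball of radius `p` (mean
  values over `p` concentric boxes, `BoxDirichlet.sub_mul_abs_le_sum`, and Cauchy–Schwarz).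

Everything is proved; no named fact.

## References

* S. Smirnov, Ann. of Math. 172 (2010), §5 [Smirnov2010].
* D. Chelkak, C. Hongler, K. Izyurov, Ann. of Math. 181 (2015), Thm 3.12 [ChelkakHonglerIzyurovAnnals2015].
-/

noncomputable section

namespace Literature.Probability.LatticeModels

open Finset Real Complex

/-- **Edge functions of a bulk s-holomorphic bond function are lattice-harmonic** (real and
imaginary parts, horizontal `i = 0` and vertical `i = 1` edges). [cite: Smirnov2010, Remark 3.3] -/
theorem isLatticeHarmonicOn_edgeFun_of_isSHolAt {G : MedialVertex → ℂ} {c : Site 2} {R : ℤ}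
    (h : ∀ y ∈ latticeBall c (R + 2), ∀ k : Fin 4, IsSHolAt G (y, k)) (i : Fin 4) (hi : i = 0 ∨ i = 1) :
    IsLatticeHarmonicOn (fun u => (edgeFun G i u).re) (latticeBall c R : Set (Site 2)) ∧
    IsLatticeHarmonicOn (fun u => (edgeFun G i u).im) (latticeBall c R : Set (Site 2)) := by
  have key : ∀ v ∈ latticeBall c R, (∑ k : Fin 4, edgeFun G i (v + cornerUnit k)) - 4 * edgeFun G i v = 0 := by
    intro v hv
    have hv2 : ∀ y ∈ latticeBall v 2, ∀ k : Fin 4, IsSHolAt G (y, k) := by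
      intro y hy k
      refine h y ?_ k
      rw [mem_latticeBall] at hv hy ⊢
      intro j; have := hv j; have := hy j; constructor <;> linarith
    have hv0 : v ∈ latticeBall v 0 := by rw [mem_latticeBall]; intro j; constructor <;> linarith
    have hV : ∀ y ∈ latticeBall v 2, CRVertex G y := fun y hy => crVertex_of_isSHolAt (hv2 y hy)
    have hF : ∀ f ∈ latticeBall v 1, CRFace G f := fun f hf =>
      crFace_of_isSHolAt fun j => hv2 _ (by
        have := add_cornerOff_mem_latticeBall hf j; norm_num at this; exact this) j
    have m1 : ∀ k : Fin 4, v + cornerUnit k ∈ latticeBall v 2 := fun k =>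
      latticeBall_subset (by norm_num) (add_cornerUnit_mem_latticeBall hv0 k)
    have m2 : ∀ k : Fin 4, v - cornerUnit k ∈ latticeBall v 1 := fun k => by
      have := add_cornerUnit_mem_latticeBall hv0 (k + 2)
      rw [cornerUnit_add_two, ← sub_eq_add_neg] at this
      norm_num at this; exact this
    have hvv : v ∈ latticeBall v 2 := latticeBall_subset (by norm_num) hv0
    have hv1 : v ∈ latticeBall v 1 := latticeBall_subset (by norm_num) hv0
    rcases hi with rfl | rfl
    · exact sum_edgeFun_zero_sub (hV v hvv) (hV _ (m1 0)) (hF v hv1) (hF _ (m2 1))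
    · exact sum_edgeFun_one_sub (hV v hvv) (hV _ (m1 1)) (hF v hv1) (hF _ (m2 0))
  constructor
  · intro v hv
    have e := congrArg Complex.re (key v hv)
    simp only [Complex.sub_re, Complex.re_sum, Complex.mul_re, Complex.zero_re] at e
    unfold latticeLaplacian
    norm_num at e
    rw [Fin.sum_univ_four] at e ⊢
    linarith
  · intro v hv
    have e := congrArg Complex.im (key v hv)
    simp only [Complex.sub_im, Complex.im_sum, Complex.mul_im, Complex.zero_im] at e
    unfold latticeLaplacian
    norm_num at e
    rw [Fin.sum_univ_four] at e ⊢
    linarith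

/-- **From `L²` to sup for a complex function with harmonic real and imaginary parts**: with
`m = 4p`, `p ≥ 8`, if `Re g`, `Im g` are lattice-harmonic on the ball of radius `4m` about the
centre of the box of side `4m` at `a` and `∑_{ball m} ‖g‖² ≤ K m`, then on the ball of radius `p`,
`‖g x‖ ≤ 96 C_geom √(4K) / √p`. [cite: Smirnov2010, §5 (precompactness)] -/
theorem norm_le_of_harmonic_of_sum_sq_le {g : Site 2 → ℂ} {a : Site 2} {p : ℕ} (hp : 8 ≤ p)
    (hre : IsLatticeHarmonicOn (fun u => (g u).re) (latticeBall (boxCentre a (4 * p)) (2 * (2 * (4 * p))) : Set (Site 2)))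
    (him : IsLatticeHarmonicOn (fun u => (g u).im) (latticeBall (boxCentre a (4 * p)) (2 * (2 * (4 * p))) : Set (Site 2)))
    {K : ℝ} (hK : 0 ≤ K) (hL2 : ∑ y ∈ latticeBall (boxCentre a (4 * p)) (4 * p), ‖g y‖ ^ 2 ≤ K * (4 * p : ℕ))
    {x : Site 2} (hx : x ∈ latticeBall (boxCentre a (4 * p)) p) :
    ‖g x‖ ≤ 96 * geomConst * Real.sqrt (4 * K) / Real.sqrt p := by
  set m := 4 * p with hm
  set c := boxCentre a m with hc
  have hp0 : 0 < p := by omega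
  have hpr : (0 : ℝ) < p := by exact_mod_cast hp0
  have hmr : (m : ℝ) = 4 * p := by rw [hm]; push_cast; ring
  have hxc := (mem_latticeBall_boxCentre (a := a) (m := m) (R := p) (y := x)).1 hx
  have hboxes : ∀ n ∈ Ico p (2 * p), boxInterior (cornerOf x n) (2 * n) ⊆ (latticeBall c (2 * (2 * m)) : Set (Site 2)) := by
    intro n hn y hy
    have hn2 := (Finset.mem_Ico.1 hn).2
    obtain ⟨k0, k0', k1, k1'⟩ := hy
    simp only [cornerOf, Matrix.cons_val_zero, Matrix.cons_val_one] at k0 k0' k1 k1'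
    push_cast at k0' k1'
    show y ∈ latticeBall c (2 * (2 * m))
    rw [hc, mem_latticeBall_boxCentre]
    omega
  have hsides : ∀ n ∈ Ico p (2 * p), ∀ j ∈ Ico 1 (2 * n),
      (![x 0 - n + j, x 1 + n] : Site 2) ∈ latticeBall c m ∧ (![x 0 - n + j, x 1 - n] : Site 2) ∈ latticeBall c m ∧
      (![x 0 - n, x 1 - n + j] : Site 2) ∈ latticeBall c m ∧ (![x 0 + n, x 1 - n + j] : Site 2) ∈ latticeBall c m := by
    intro n hn j hj
    have hn2 := (Finset.mem_Ico.1 hn).2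
    have hj1 := (Finset.mem_Ico.1 hj).1
    have hj2 := (Finset.mem_Ico.1 hj).2
    simp only [hc, mem_latticeBall_boxCentre, Matrix.cons_val_zero, Matrix.cons_val_one]
    omega
  have hest : ∀ f : Site 2 → ℝ, IsLatticeHarmonicOn f (latticeBall c (2 * (2 * m)) : Set (Site 2)) →
      (p : ℝ) * |f x| ≤ 4 * geomConst / p * ∑ y ∈ latticeBall c m, |f y| := by
    intro f hf
    have := sub_mul_abs_le_sum (x := x) (n₁ := p) (n₂ := 2 * p) hp (h := f)
      (fun n hn => fun y hy => hf y (hboxes n hn hy)) (latticeBall c m) (fun n hn j hj => hsides n hn j hj)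
    rw [show 2 * p - p = p by omega] at this
    exact this
  have hcard : ((latticeBall c m).card : ℝ) = (2 * m + 1) ^ 2 := by
    rw [latticeBall, Fintype.card_piFinset, Fin.prod_univ_two, Int.card_Icc, Int.card_Icc]
    have e1 : (c 0 + (m : ℤ) + 1 - (c 0 - m)).toNat = 2 * m + 1 := by omega
    have e2 : (c 1 + (m : ℤ) + 1 - (c 1 - m)).toNat = 2 * m + 1 := by omega
    rw [e1, e2]; push_cast; ring
  have hsumF : ∑ y ∈ latticeBall c m, ‖g y‖ ^ 2 ≤ K * m := by simpa [hm] using hL2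
  set D : ℝ := Real.sqrt (4 * K) with hD
  have hD0 : 0 ≤ D := Real.sqrt_nonneg _
  have hD2 : D ^ 2 = 4 * K := Real.sq_sqrt (by positivity)
  have hsp : Real.sqrt p ^ 2 = p := Real.sq_sqrt hpr.le
  have hsp0 : 0 < Real.sqrt p := Real.sqrt_pos.2 hpr
  have hS : ∀ f : Site 2 → ℝ, (∀ y, f y ^ 2 ≤ ‖g y‖ ^ 2) → ∑ y ∈ latticeBall c m, |f y| ≤ 12 * p * (D * Real.sqrt p) := by
    intro f hf
    have cs := Finset.sum_mul_sq_le_sq_mul_sq (latticeBall c m) (fun y => |f y|) (fun _ => (1 : ℝ))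
    simp only [mul_one, one_pow, Finset.sum_const, nsmul_eq_mul, mul_one, hcard, sq_abs] at cs
    have h1 : (∑ y ∈ latticeBall c m, |f y|) ^ 2 ≤ (12 * p * (D * Real.sqrt p)) ^ 2 := by
      calc (∑ y ∈ latticeBall c m, |f y|) ^ 2 ≤ (∑ y ∈ latticeBall c m, f y ^ 2) * (2 * m + 1) ^ 2 := cs
        _ ≤ (K * m) * (2 * m + 1) ^ 2 :=
            mul_le_mul_of_nonneg_right ((Finset.sum_le_sum fun y _ => hf y).trans hsumF) (by positivity)
        _ ≤ (12 * p * (D * Real.sqrt p)) ^ 2 := by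
            rw [mul_pow, mul_pow, mul_pow, hD2, hsp, hmr]
            have hp1 : (1 : ℝ) ≤ p := Nat.one_le_cast.2 hp0
            have key : (2 * (4 * (p : ℝ)) + 1) ^ 2 ≤ 81 * p ^ 2 := by nlinarith
            have hX : 0 ≤ K * p := by positivity
            calc K * (4 * (p : ℝ)) * (2 * (4 * (p : ℝ)) + 1) ^ 2 = (4 * (K * p)) * (2 * (4 * (p : ℝ)) + 1) ^ 2 := by ring
              _ ≤ (4 * (K * p)) * (81 * p ^ 2) := mul_le_mul_of_nonneg_left key (by positivity)
              _ ≤ 12 ^ 2 * (p : ℝ) ^ 2 * (4 * K * p) := by nlinarith [hX]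
    have hnn : 0 ≤ ∑ y ∈ latticeBall c m, |f y| := Finset.sum_nonneg fun y _ => abs_nonneg _
    exact (pow_le_pow_iff_left₀ hnn (by positivity) two_ne_zero).1 h1
  have hbound : ∀ f : Site 2 → ℝ, IsLatticeHarmonicOn f (latticeBall c (2 * (2 * m)) : Set (Site 2)) →
      (∀ y, f y ^ 2 ≤ ‖g y‖ ^ 2) → |f x| ≤ 48 * geomConst * D / Real.sqrt p := by
    intro f hf hf2
    have e1 := hest f hf
    have e2 := hS f hf2
    have hg0 := geomConst_pos
    have e3 : (p : ℝ) * |f x| ≤ 4 * geomConst / p * (12 * p * (D * Real.sqrt p)) :=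
      e1.trans (mul_le_mul_of_nonneg_left e2 (by positivity))
    rw [le_div_iff₀ hsp0]
    have e4 : 4 * geomConst / p * (12 * p * (D * Real.sqrt p)) = 48 * geomConst * D * Real.sqrt p := by
      field_simp; ring
    rw [e4] at e3
    have e5 : |f x| * Real.sqrt p * Real.sqrt p ≤ 48 * geomConst * D * Real.sqrt p := by
      rw [mul_assoc, ← sq, hsp, mul_comm]; exact e3
    exact le_of_mul_le_mul_right e5 hsp0
  have hre' := hbound (fun u => (g u).re) hre fun y => (re_sq_le_norm_sq (g y)).1
  have him' := hbound (fun u => (g u).im) him fun y => (re_sq_le_norm_sq (g y)).2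
  calc ‖g x‖ ≤ |(g x).re| + |(g x).im| := norm_le_abs_re_add_abs_im' _
    _ ≤ 48 * geomConst * D / Real.sqrt p + 48 * geomConst * D / Real.sqrt p := add_le_add hre' him'
    _ = 96 * geomConst * Real.sqrt (4 * K) / Real.sqrt p := by rw [hD]; ring

end Literature.Probability.LatticeModels
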